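/-
Copyright: the b2b-balaban T⁴-continuum CRUX team, row NE7b OWNER lineage `t4-ne7b-p1` (gen 143). Project licence.
-/
import Summits.QuantumFields.BalabanUV.T4Continuum.Spine.NE7b.SupWhitenedFifthCumulantRowLetter
import Summits.QuantumFields.BalabanUV.T4Continuum.Spine.NE7b.SupFiniteRangeFourthCumulant

/-!
# THE FIFTH CUMULANT'S ROW LETTER FOR A FINITE-RANGE FACTOR (SCOPING (d14)(2)(iii), fourth file of gen 143): (560) with every weight INSTANTIATED
# as in (476)∕(499) and the admissible `D` := the Neumann series of (485) — the order-5 analogue of (499).  Sites placed by `p : ι → X`, sampler indices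
# by `q : κ → X` in one pseudometric space; `θ_{zw} = e^{8μd(qz,qw)}`, `σ_{xw} = e^{8μd(px,qw)}`, the site weight `r_{xy} = e^{(μ∕3)d(px,py)}` (symmetric,
# `≥ 1`, `r²⁴ = e^{8μd} ≤ σσ` by (499) `r_pow_24_le`); a factor of range `R`, a Hessian majorant of range `R′`.  Then `αθ = βθ = e^{8μ(R+R′)}·hr·αr`,
# `dθ = (1−γθ)⁻¹`, `dθ′ = (1−γθ′)⁻¹` by (485), and
#   `Σ_{x₂}Σ_{x₃}Σ_{x₄}Σ_{x₅} |u₅(F_{x₁},…,F_{x₅})| ≤ (C₁ + C₂)·(576·S⁴)`,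
# `C₁ = 4K + 5M₆ + M₂M₄ + 2K(M₂+M₄) + 24M₂√(KM₄)`, `C₂ = 6K + 5M₆ + (M₂+M₄)²∕2 + 3M₂M₄ + 3K(M₂+M₄) + 12M₂√(KM₄)`, `K = αθ²(1−γθ)⁻¹(1−γθ′)⁻¹∕(1−lamA)`,
# `M₄ = 5κ₂⁴γ_op²∕(1−λγ_op)²`, `M₂ = (M₄+1)∕2`, `M₆ = 50κ₂⁶γ_op³∕(1−λγ_op)³`, with ONLY the site letter `Σ_v e^{−(μ∕3)d(pu,pv)} ≤ S` and the weighted smallness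
# `γθ, γθ′ < 1` left as hypotheses — NO moment letter (row NE7b, node U5c; (560), (499), (476), (485) BY NAME; [folklore])

Cell `pub-balaban`, sub-cell `t4`, spine estimate NE7b (`T4WeightBudget.RelWeightBound`; the cell's OWN estimate — NOT PRINTED in
[Bałaban 1983–89], NOT PROVED).  Crux-route work under `Spine/NE7b/` by the row OWNER (`t4-ne7b-p1` gen 143, file (561)) under FREEZE
(0)'s crux-prover clause; NOTHING of Bałaban's is named as a Lean object, valued or asserted; no `T4Continuum/Support` leaf typed; no
`def`, no notation (weights, `D`, `u₅`, constants WRITTEN OUT); zero `sorry`.  Imports (BY NAME): the OWNER's (560) `…SupWhitenedFifthCumulantRowLetter`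
(`whitened_fifth_cumulant_row_letter`), (499) `…SupFiniteRangeFourthCumulant` (`r_pow_24_le`; through it (476) `expw_one_le`, `expw_triangle`, `sigma_theta`,
`weighted_cross_rowsum_le`, `weighted_cross_colsum_le`, `weighted_obs_rowsum_le`, `weighted_obs_entry_le`, (485) `neumannD_nonneg`, `neumannD_dominates`,
`neumannD_weighted_rowsum`, `neumannD_weighted_colsum`).

WHAT IS PROVED ([folklore]): THE END **`finite_range_fifth_cumulant_row_letter`**; toy.

HONEST (what this is NOT).  The cumulant piece's row letter at order 5 for a finite-range factor, `S` a letter; the other pieces of `∂⁵W`, its cumulant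
form and the assembly are NOT typed; scalar skeleton ((A3), NC-NE7b-α UNRULED); nothing of Bałaban's asserted.  BY-NAME EFFECT ON THE WALL: NONE.  NE7b
NOT PRINTED ∕ NOT PROVED; spine PROVED 0∕9; rung (B)+1 — the programme's measures remain FINITE-torus statements; NOT the mass gap, NOT Clay.  HONEST
DEPENDENCY: continuum YM on T⁴ ⇐ BetaPertH ∧ nine spine estimates (0∕9 proved); BetaPertH ⇐ (D1) ∧ (D4) ∧ CAP+tail; G-an2-4 gates asym, D1 and NE2∕3∕4.
-/

set_option autoImplicit false
set_option maxSynthPendingDepth 2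

noncomputable section

namespace Summit.QuantumFields.BalabanUV.T4Continuum.NE7b.SupFiniteRangeFifthCumulant

open MeasureTheory ProbabilityTheory Real Set Function Finset Matrix
open scoped BigOperators
open Literature.Probability.Distributions (matrixCLM)
open SupWhitenedFifthCumulantRowLetter (whitened_fifth_cumulant_row_letter)
open SupFiniteRangeFourthCumulant (r_pow_24_le)
open SupFiniteRangeGeometryLetters (expw_one_le expw_triangle sigma_theta weighted_cross_rowsum_le weighted_cross_colsum_le
  weighted_obs_rowsum_le weighted_obs_entry_le)
open SupWhitenedNeumannAdmissible (neumannD_nonneg neumannD_dominates neumannD_weighted_rowsum neumannD_weighted_colsum)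

variable {ι κ X : Type} [Fintype ι] [DecidableEq ι] [Fintype κ] [DecidableEq κ] [PseudoMetricSpace X]

variable {U : EuclideanSpace ℝ ι → ℝ} {U' : EuclideanSpace ℝ ι → EuclideanSpace ℝ ι →L[ℝ] ℝ}
  {U'' : EuclideanSpace ℝ ι → EuclideanSpace ℝ ι →L[ℝ] EuclideanSpace ℝ ι →L[ℝ] ℝ} {Hk : ι → ι → ℝ} {A : Matrix ι κ ℝ} {p : ι → X} {q : κ → X}
  {γop κ₀ κ₁ κ₂ a τ δ θp lam lamA αr αc hr hc γ μ R R' S : ℝ}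

/-! ## THE END: the row letter for a finite-range factor -/

/-- **THE END — THE FIFTH CUMULANT'S ROW LETTER FOR A FINITE-RANGE FACTOR** (`S` the only letter; the weighted smallness `γθ, γθ′ < 1` a hypothesis on
plain letters × range factors). [folklore] -/
theorem finite_range_fifth_cumulant_row_letter [Nonempty κ] (hΓop : (γop • (1 : Matrix ι ι ℝ) - A * Aᵀ).PosSemidef) (Y : Finset ι)
    (hUd : ∀ φ : EuclideanSpace ℝ ι, HasFDerivAt U (U' φ) φ) (hU'd : ∀ φ : EuclideanSpace ℝ ι, HasFDerivAt U' (U'' φ) φ)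
    (hU''c : Continuous U'') (hκ₀ : 0 ≤ κ₀) (hκ₁ : 0 ≤ κ₁) (ha : 0 ≤ a) (hτ : 0 < τ) (hδ : 0 < δ) (hθ0 : 0 < θp) (hθ1 : θp < 1)
    (hκθ : (2 * κ₀ * (1 + τ) + 4 * δ) * γop ≤ θp) (hκθw : 2 * κ₀ * (1 + τ) * γop + 4 * δ ≤ θp)
    (hstab : ∀ φ : EuclideanSpace ℝ ι, -(κ₀ * ∑ x ∈ Y, φ x ^ 2) ≤ U φ)
    (hU'b : ∀ φ : EuclideanSpace ℝ ι, ‖U' φ‖ ≤ κ₁ * (a + ∑ x ∈ Y, φ x ^ 2)) (hU''b : ∀ φ : EuclideanSpace ℝ ι, ‖U'' φ‖ ≤ κ₂) (hlam : 0 ≤ lam)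
    (hUsec : ∀ s : ℝ, 0 ≤ s → s ≤ 1 → ∀ a b : EuclideanSpace ℝ ι,
      U ((1 - s) • a + s • b) - lam / 2 * (s * (1 - s)) * ∑ i, (a i - b i) ^ 2 ≤ (1 - s) * U a + s * U b)
    (hρg : lam * γop < 1)
    (hHk : ∀ (φ : EuclideanSpace ℝ ι) (x z : ι), |U'' φ (EuclideanSpace.single z (1 : ℝ)) (EuclideanSpace.single x (1 : ℝ))| ≤ Hk x z)
    (hHk0 : ∀ v u, 0 ≤ Hk v u) (ψ : EuclideanSpace ℝ ι)
    (hαr : ∀ u, ∑ w, |A u w| ≤ αr) (hαc : ∀ w, ∑ u, |A u w| ≤ αc) (hhr : ∀ v, ∑ u, Hk v u ≤ hr) (hhc : ∀ u, ∑ v, Hk v u ≤ hc)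
    (hlamA : ∀ x : κ, ∑ u, ∑ v, |A u x| * |A v x| * Hk v u ≤ lamA) (hlamA1 : lamA < 1) (hγ : αc * hr * αr / (1 - lamA) ≤ γ) (hγ1 : γ < 1)
    -- the geometry: placements, rate, ranges, the weighted smallness
    (hμ : 0 ≤ μ) (hAR : ∀ u w, A u w = 0 ∨ dist (p u) (q w) ≤ R) (hHkR : ∀ v u, Hk v u = 0 ∨ dist (p v) (p u) ≤ R')
    (hγθ1 : (Real.exp (8 * μ * (2 * R + R')) * (αc * hr * αr) / (1 - lamA)) < 1) (hγθ'1 : (Real.exp (8 * μ * (2 * R + R')) * (αc * hc * αr) / (1 -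
        lamA)) < 1)
    -- the site letter
    (hS : ∀ u, ∑ v, (Real.exp (μ / 3 * dist (p u) (p v)))⁻¹ ≤ S) (x₁ : ι) :
    ∑ x₂, ∑ x₃, ∑ x₄, ∑ x₅, |(∫ w, (U' (matrixCLM A (WithLp.toLp 2 w) + ψ) (EuclideanSpace.single x₁ (1 : ℝ)) - (∫ w', U' (matrixCLM A (WithLp.toLp 2
        w') + ψ) (EuclideanSpace.single x₁ (1 : ℝ)) ∂((volume : Measure (κ → ℝ)).tilted fun z => -(1 / 2 * (z ⬝ᵥ z) + U (matrixCLM A (WithLp.toLp 2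
        z) + ψ))))) * (U' (matrixCLM A (WithLp.toLp 2 w) + ψ) (EuclideanSpace.single x₂ (1 : ℝ)) - (∫ w', U' (matrixCLM A (WithLp.toLp 2 w') + ψ)
        (EuclideanSpace.single x₂ (1 : ℝ)) ∂((volume : Measure (κ → ℝ)).tilted fun z => -(1 / 2 * (z ⬝ᵥ z) + U (matrixCLM A (WithLp.toLp 2 z) +
        ψ))))) * (U' (matrixCLM A (WithLp.toLp 2 w) + ψ) (EuclideanSpace.single x₃ (1 : ℝ)) - (∫ w', U' (matrixCLM A (WithLp.toLp 2 w') + ψ)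
        (EuclideanSpace.single x₃ (1 : ℝ)) ∂((volume : Measure (κ → ℝ)).tilted fun z => -(1 / 2 * (z ⬝ᵥ z) + U (matrixCLM A (WithLp.toLp 2 z) +
        ψ))))) * (U' (matrixCLM A (WithLp.toLp 2 w) + ψ) (EuclideanSpace.single x₄ (1 : ℝ)) - (∫ w', U' (matrixCLM A (WithLp.toLp 2 w') + ψ)
        (EuclideanSpace.single x₄ (1 : ℝ)) ∂((volume : Measure (κ → ℝ)).tilted fun z => -(1 / 2 * (z ⬝ᵥ z) + U (matrixCLM A (WithLp.toLp 2 z) +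
        ψ))))) * (U' (matrixCLM A (WithLp.toLp 2 w) + ψ) (EuclideanSpace.single x₅ (1 : ℝ)) - (∫ w', U' (matrixCLM A (WithLp.toLp 2 w') + ψ)
        (EuclideanSpace.single x₅ (1 : ℝ)) ∂((volume : Measure (κ → ℝ)).tilted fun z => -(1 / 2 * (z ⬝ᵥ z) + U (matrixCLM A (WithLp.toLp 2 z) +
        ψ))))) ∂((volume : Measure (κ → ℝ)).tilted fun z => -(1 / 2 * (z ⬝ᵥ z) + U (matrixCLM A (WithLp.toLp 2 z) + ψ)))) -
        ((∫ w, (U' (matrixCLM A (WithLp.toLp 2 w) + ψ) (EuclideanSpace.single x₁ (1 : ℝ)) - (∫ w', U' (matrixCLM A (WithLp.toLp 2 w') + ψ)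
            (EuclideanSpace.single x₁ (1 : ℝ)) ∂((volume : Measure (κ → ℝ)).tilted fun z => -(1 / 2 * (z ⬝ᵥ z) + U (matrixCLM A (WithLp.toLp 2 z) +
            ψ))))) * (U' (matrixCLM A (WithLp.toLp 2 w) + ψ) (EuclideanSpace.single x₂ (1 : ℝ)) - (∫ w', U' (matrixCLM A (WithLp.toLp 2 w') + ψ)
            (EuclideanSpace.single x₂ (1 : ℝ)) ∂((volume : Measure (κ → ℝ)).tilted fun z => -(1 / 2 * (z ⬝ᵥ z) + U (matrixCLM A (WithLp.toLp 2 z) +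
            ψ))))) ∂((volume : Measure (κ → ℝ)).tilted fun z => -(1 / 2 * (z ⬝ᵥ z) + U (matrixCLM A (WithLp.toLp 2 z) + ψ)))) * (∫ w, (U' (matrixCLM
            A (WithLp.toLp 2 w) + ψ) (EuclideanSpace.single x₃ (1 : ℝ)) - (∫ w', U' (matrixCLM A (WithLp.toLp 2 w') + ψ) (EuclideanSpace.single x₃ (1
            : ℝ)) ∂((volume : Measure (κ → ℝ)).tilted fun z => -(1 / 2 * (z ⬝ᵥ z) + U (matrixCLM A (WithLp.toLp 2 z) + ψ))))) * (U' (matrixCLM A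
            (WithLp.toLp 2 w) + ψ) (EuclideanSpace.single x₄ (1 : ℝ)) - (∫ w', U' (matrixCLM A (WithLp.toLp 2 w') + ψ) (EuclideanSpace.single x₄ (1 :
            ℝ)) ∂((volume : Measure (κ → ℝ)).tilted fun z => -(1 / 2 * (z ⬝ᵥ z) + U (matrixCLM A (WithLp.toLp 2 z) + ψ))))) * (U' (matrixCLM A
            (WithLp.toLp 2 w) + ψ) (EuclideanSpace.single x₅ (1 : ℝ)) - (∫ w', U' (matrixCLM A (WithLp.toLp 2 w') + ψ) (EuclideanSpace.single x₅ (1 :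
            ℝ)) ∂((volume : Measure (κ → ℝ)).tilted fun z => -(1 / 2 * (z ⬝ᵥ z) + U (matrixCLM A (WithLp.toLp 2 z) + ψ))))) ∂((volume : Measure (κ →
            ℝ)).tilted fun z => -(1 / 2 * (z ⬝ᵥ z) + U (matrixCLM A (WithLp.toLp 2 z) + ψ)))) +
        (∫ w, (U' (matrixCLM A (WithLp.toLp 2 w) + ψ) (EuclideanSpace.single x₁ (1 : ℝ)) - (∫ w', U' (matrixCLM A (WithLp.toLp 2 w') + ψ)
            (EuclideanSpace.single x₁ (1 : ℝ)) ∂((volume : Measure (κ → ℝ)).tilted fun z => -(1 / 2 * (z ⬝ᵥ z) + U (matrixCLM A (WithLp.toLp 2 z) +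
            ψ))))) * (U' (matrixCLM A (WithLp.toLp 2 w) + ψ) (EuclideanSpace.single x₃ (1 : ℝ)) - (∫ w', U' (matrixCLM A (WithLp.toLp 2 w') + ψ)
            (EuclideanSpace.single x₃ (1 : ℝ)) ∂((volume : Measure (κ → ℝ)).tilted fun z => -(1 / 2 * (z ⬝ᵥ z) + U (matrixCLM A (WithLp.toLp 2 z) +
            ψ))))) ∂((volume : Measure (κ → ℝ)).tilted fun z => -(1 / 2 * (z ⬝ᵥ z) + U (matrixCLM A (WithLp.toLp 2 z) + ψ)))) * (∫ w, (U' (matrixCLM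
            A (WithLp.toLp 2 w) + ψ) (EuclideanSpace.single x₂ (1 : ℝ)) - (∫ w', U' (matrixCLM A (WithLp.toLp 2 w') + ψ) (EuclideanSpace.single x₂ (1
            : ℝ)) ∂((volume : Measure (κ → ℝ)).tilted fun z => -(1 / 2 * (z ⬝ᵥ z) + U (matrixCLM A (WithLp.toLp 2 z) + ψ))))) * (U' (matrixCLM A
            (WithLp.toLp 2 w) + ψ) (EuclideanSpace.single x₄ (1 : ℝ)) - (∫ w', U' (matrixCLM A (WithLp.toLp 2 w') + ψ) (EuclideanSpace.single x₄ (1 :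
            ℝ)) ∂((volume : Measure (κ → ℝ)).tilted fun z => -(1 / 2 * (z ⬝ᵥ z) + U (matrixCLM A (WithLp.toLp 2 z) + ψ))))) * (U' (matrixCLM A
            (WithLp.toLp 2 w) + ψ) (EuclideanSpace.single x₅ (1 : ℝ)) - (∫ w', U' (matrixCLM A (WithLp.toLp 2 w') + ψ) (EuclideanSpace.single x₅ (1 :
            ℝ)) ∂((volume : Measure (κ → ℝ)).tilted fun z => -(1 / 2 * (z ⬝ᵥ z) + U (matrixCLM A (WithLp.toLp 2 z) + ψ))))) ∂((volume : Measure (κ →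
            ℝ)).tilted fun z => -(1 / 2 * (z ⬝ᵥ z) + U (matrixCLM A (WithLp.toLp 2 z) + ψ)))) +
        (∫ w, (U' (matrixCLM A (WithLp.toLp 2 w) + ψ) (EuclideanSpace.single x₁ (1 : ℝ)) - (∫ w', U' (matrixCLM A (WithLp.toLp 2 w') + ψ)
            (EuclideanSpace.single x₁ (1 : ℝ)) ∂((volume : Measure (κ → ℝ)).tilted fun z => -(1 / 2 * (z ⬝ᵥ z) + U (matrixCLM A (WithLp.toLp 2 z) +
            ψ))))) * (U' (matrixCLM A (WithLp.toLp 2 w) + ψ) (EuclideanSpace.single x₄ (1 : ℝ)) - (∫ w', U' (matrixCLM A (WithLp.toLp 2 w') + ψ)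
            (EuclideanSpace.single x₄ (1 : ℝ)) ∂((volume : Measure (κ → ℝ)).tilted fun z => -(1 / 2 * (z ⬝ᵥ z) + U (matrixCLM A (WithLp.toLp 2 z) +
            ψ))))) ∂((volume : Measure (κ → ℝ)).tilted fun z => -(1 / 2 * (z ⬝ᵥ z) + U (matrixCLM A (WithLp.toLp 2 z) + ψ)))) * (∫ w, (U' (matrixCLM
            A (WithLp.toLp 2 w) + ψ) (EuclideanSpace.single x₂ (1 : ℝ)) - (∫ w', U' (matrixCLM A (WithLp.toLp 2 w') + ψ) (EuclideanSpace.single x₂ (1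
            : ℝ)) ∂((volume : Measure (κ → ℝ)).tilted fun z => -(1 / 2 * (z ⬝ᵥ z) + U (matrixCLM A (WithLp.toLp 2 z) + ψ))))) * (U' (matrixCLM A
            (WithLp.toLp 2 w) + ψ) (EuclideanSpace.single x₃ (1 : ℝ)) - (∫ w', U' (matrixCLM A (WithLp.toLp 2 w') + ψ) (EuclideanSpace.single x₃ (1 :
            ℝ)) ∂((volume : Measure (κ → ℝ)).tilted fun z => -(1 / 2 * (z ⬝ᵥ z) + U (matrixCLM A (WithLp.toLp 2 z) + ψ))))) * (U' (matrixCLM A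
            (WithLp.toLp 2 w) + ψ) (EuclideanSpace.single x₅ (1 : ℝ)) - (∫ w', U' (matrixCLM A (WithLp.toLp 2 w') + ψ) (EuclideanSpace.single x₅ (1 :
            ℝ)) ∂((volume : Measure (κ → ℝ)).tilted fun z => -(1 / 2 * (z ⬝ᵥ z) + U (matrixCLM A (WithLp.toLp 2 z) + ψ))))) ∂((volume : Measure (κ →
            ℝ)).tilted fun z => -(1 / 2 * (z ⬝ᵥ z) + U (matrixCLM A (WithLp.toLp 2 z) + ψ)))) +
        (∫ w, (U' (matrixCLM A (WithLp.toLp 2 w) + ψ) (EuclideanSpace.single x₁ (1 : ℝ)) - (∫ w', U' (matrixCLM A (WithLp.toLp 2 w') + ψ)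
            (EuclideanSpace.single x₁ (1 : ℝ)) ∂((volume : Measure (κ → ℝ)).tilted fun z => -(1 / 2 * (z ⬝ᵥ z) + U (matrixCLM A (WithLp.toLp 2 z) +
            ψ))))) * (U' (matrixCLM A (WithLp.toLp 2 w) + ψ) (EuclideanSpace.single x₅ (1 : ℝ)) - (∫ w', U' (matrixCLM A (WithLp.toLp 2 w') + ψ)
            (EuclideanSpace.single x₅ (1 : ℝ)) ∂((volume : Measure (κ → ℝ)).tilted fun z => -(1 / 2 * (z ⬝ᵥ z) + U (matrixCLM A (WithLp.toLp 2 z) +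
            ψ))))) ∂((volume : Measure (κ → ℝ)).tilted fun z => -(1 / 2 * (z ⬝ᵥ z) + U (matrixCLM A (WithLp.toLp 2 z) + ψ)))) * (∫ w, (U' (matrixCLM
            A (WithLp.toLp 2 w) + ψ) (EuclideanSpace.single x₂ (1 : ℝ)) - (∫ w', U' (matrixCLM A (WithLp.toLp 2 w') + ψ) (EuclideanSpace.single x₂ (1
            : ℝ)) ∂((volume : Measure (κ → ℝ)).tilted fun z => -(1 / 2 * (z ⬝ᵥ z) + U (matrixCLM A (WithLp.toLp 2 z) + ψ))))) * (U' (matrixCLM A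
            (WithLp.toLp 2 w) + ψ) (EuclideanSpace.single x₃ (1 : ℝ)) - (∫ w', U' (matrixCLM A (WithLp.toLp 2 w') + ψ) (EuclideanSpace.single x₃ (1 :
            ℝ)) ∂((volume : Measure (κ → ℝ)).tilted fun z => -(1 / 2 * (z ⬝ᵥ z) + U (matrixCLM A (WithLp.toLp 2 z) + ψ))))) * (U' (matrixCLM A
            (WithLp.toLp 2 w) + ψ) (EuclideanSpace.single x₄ (1 : ℝ)) - (∫ w', U' (matrixCLM A (WithLp.toLp 2 w') + ψ) (EuclideanSpace.single x₄ (1 :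
            ℝ)) ∂((volume : Measure (κ → ℝ)).tilted fun z => -(1 / 2 * (z ⬝ᵥ z) + U (matrixCLM A (WithLp.toLp 2 z) + ψ))))) ∂((volume : Measure (κ →
            ℝ)).tilted fun z => -(1 / 2 * (z ⬝ᵥ z) + U (matrixCLM A (WithLp.toLp 2 z) + ψ)))) +
        (∫ w, (U' (matrixCLM A (WithLp.toLp 2 w) + ψ) (EuclideanSpace.single x₂ (1 : ℝ)) - (∫ w', U' (matrixCLM A (WithLp.toLp 2 w') + ψ)
            (EuclideanSpace.single x₂ (1 : ℝ)) ∂((volume : Measure (κ → ℝ)).tilted fun z => -(1 / 2 * (z ⬝ᵥ z) + U (matrixCLM A (WithLp.toLp 2 z) +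
            ψ))))) * (U' (matrixCLM A (WithLp.toLp 2 w) + ψ) (EuclideanSpace.single x₃ (1 : ℝ)) - (∫ w', U' (matrixCLM A (WithLp.toLp 2 w') + ψ)
            (EuclideanSpace.single x₃ (1 : ℝ)) ∂((volume : Measure (κ → ℝ)).tilted fun z => -(1 / 2 * (z ⬝ᵥ z) + U (matrixCLM A (WithLp.toLp 2 z) +
            ψ))))) ∂((volume : Measure (κ → ℝ)).tilted fun z => -(1 / 2 * (z ⬝ᵥ z) + U (matrixCLM A (WithLp.toLp 2 z) + ψ)))) * (∫ w, (U' (matrixCLM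
            A (WithLp.toLp 2 w) + ψ) (EuclideanSpace.single x₁ (1 : ℝ)) - (∫ w', U' (matrixCLM A (WithLp.toLp 2 w') + ψ) (EuclideanSpace.single x₁ (1
            : ℝ)) ∂((volume : Measure (κ → ℝ)).tilted fun z => -(1 / 2 * (z ⬝ᵥ z) + U (matrixCLM A (WithLp.toLp 2 z) + ψ))))) * (U' (matrixCLM A
            (WithLp.toLp 2 w) + ψ) (EuclideanSpace.single x₄ (1 : ℝ)) - (∫ w', U' (matrixCLM A (WithLp.toLp 2 w') + ψ) (EuclideanSpace.single x₄ (1 :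
            ℝ)) ∂((volume : Measure (κ → ℝ)).tilted fun z => -(1 / 2 * (z ⬝ᵥ z) + U (matrixCLM A (WithLp.toLp 2 z) + ψ))))) * (U' (matrixCLM A
            (WithLp.toLp 2 w) + ψ) (EuclideanSpace.single x₅ (1 : ℝ)) - (∫ w', U' (matrixCLM A (WithLp.toLp 2 w') + ψ) (EuclideanSpace.single x₅ (1 :
            ℝ)) ∂((volume : Measure (κ → ℝ)).tilted fun z => -(1 / 2 * (z ⬝ᵥ z) + U (matrixCLM A (WithLp.toLp 2 z) + ψ))))) ∂((volume : Measure (κ →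
            ℝ)).tilted fun z => -(1 / 2 * (z ⬝ᵥ z) + U (matrixCLM A (WithLp.toLp 2 z) + ψ)))) +
        (∫ w, (U' (matrixCLM A (WithLp.toLp 2 w) + ψ) (EuclideanSpace.single x₂ (1 : ℝ)) - (∫ w', U' (matrixCLM A (WithLp.toLp 2 w') + ψ)
            (EuclideanSpace.single x₂ (1 : ℝ)) ∂((volume : Measure (κ → ℝ)).tilted fun z => -(1 / 2 * (z ⬝ᵥ z) + U (matrixCLM A (WithLp.toLp 2 z) +
            ψ))))) * (U' (matrixCLM A (WithLp.toLp 2 w) + ψ) (EuclideanSpace.single x₄ (1 : ℝ)) - (∫ w', U' (matrixCLM A (WithLp.toLp 2 w') + ψ)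
            (EuclideanSpace.single x₄ (1 : ℝ)) ∂((volume : Measure (κ → ℝ)).tilted fun z => -(1 / 2 * (z ⬝ᵥ z) + U (matrixCLM A (WithLp.toLp 2 z) +
            ψ))))) ∂((volume : Measure (κ → ℝ)).tilted fun z => -(1 / 2 * (z ⬝ᵥ z) + U (matrixCLM A (WithLp.toLp 2 z) + ψ)))) * (∫ w, (U' (matrixCLM
            A (WithLp.toLp 2 w) + ψ) (EuclideanSpace.single x₁ (1 : ℝ)) - (∫ w', U' (matrixCLM A (WithLp.toLp 2 w') + ψ) (EuclideanSpace.single x₁ (1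
            : ℝ)) ∂((volume : Measure (κ → ℝ)).tilted fun z => -(1 / 2 * (z ⬝ᵥ z) + U (matrixCLM A (WithLp.toLp 2 z) + ψ))))) * (U' (matrixCLM A
            (WithLp.toLp 2 w) + ψ) (EuclideanSpace.single x₃ (1 : ℝ)) - (∫ w', U' (matrixCLM A (WithLp.toLp 2 w') + ψ) (EuclideanSpace.single x₃ (1 :
            ℝ)) ∂((volume : Measure (κ → ℝ)).tilted fun z => -(1 / 2 * (z ⬝ᵥ z) + U (matrixCLM A (WithLp.toLp 2 z) + ψ))))) * (U' (matrixCLM A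
            (WithLp.toLp 2 w) + ψ) (EuclideanSpace.single x₅ (1 : ℝ)) - (∫ w', U' (matrixCLM A (WithLp.toLp 2 w') + ψ) (EuclideanSpace.single x₅ (1 :
            ℝ)) ∂((volume : Measure (κ → ℝ)).tilted fun z => -(1 / 2 * (z ⬝ᵥ z) + U (matrixCLM A (WithLp.toLp 2 z) + ψ))))) ∂((volume : Measure (κ →
            ℝ)).tilted fun z => -(1 / 2 * (z ⬝ᵥ z) + U (matrixCLM A (WithLp.toLp 2 z) + ψ)))) +
        (∫ w, (U' (matrixCLM A (WithLp.toLp 2 w) + ψ) (EuclideanSpace.single x₂ (1 : ℝ)) - (∫ w', U' (matrixCLM A (WithLp.toLp 2 w') + ψ)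
            (EuclideanSpace.single x₂ (1 : ℝ)) ∂((volume : Measure (κ → ℝ)).tilted fun z => -(1 / 2 * (z ⬝ᵥ z) + U (matrixCLM A (WithLp.toLp 2 z) +
            ψ))))) * (U' (matrixCLM A (WithLp.toLp 2 w) + ψ) (EuclideanSpace.single x₅ (1 : ℝ)) - (∫ w', U' (matrixCLM A (WithLp.toLp 2 w') + ψ)
            (EuclideanSpace.single x₅ (1 : ℝ)) ∂((volume : Measure (κ → ℝ)).tilted fun z => -(1 / 2 * (z ⬝ᵥ z) + U (matrixCLM A (WithLp.toLp 2 z) +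
            ψ))))) ∂((volume : Measure (κ → ℝ)).tilted fun z => -(1 / 2 * (z ⬝ᵥ z) + U (matrixCLM A (WithLp.toLp 2 z) + ψ)))) * (∫ w, (U' (matrixCLM
            A (WithLp.toLp 2 w) + ψ) (EuclideanSpace.single x₁ (1 : ℝ)) - (∫ w', U' (matrixCLM A (WithLp.toLp 2 w') + ψ) (EuclideanSpace.single x₁ (1
            : ℝ)) ∂((volume : Measure (κ → ℝ)).tilted fun z => -(1 / 2 * (z ⬝ᵥ z) + U (matrixCLM A (WithLp.toLp 2 z) + ψ))))) * (U' (matrixCLM A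
            (WithLp.toLp 2 w) + ψ) (EuclideanSpace.single x₃ (1 : ℝ)) - (∫ w', U' (matrixCLM A (WithLp.toLp 2 w') + ψ) (EuclideanSpace.single x₃ (1 :
            ℝ)) ∂((volume : Measure (κ → ℝ)).tilted fun z => -(1 / 2 * (z ⬝ᵥ z) + U (matrixCLM A (WithLp.toLp 2 z) + ψ))))) * (U' (matrixCLM A
            (WithLp.toLp 2 w) + ψ) (EuclideanSpace.single x₄ (1 : ℝ)) - (∫ w', U' (matrixCLM A (WithLp.toLp 2 w') + ψ) (EuclideanSpace.single x₄ (1 :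
            ℝ)) ∂((volume : Measure (κ → ℝ)).tilted fun z => -(1 / 2 * (z ⬝ᵥ z) + U (matrixCLM A (WithLp.toLp 2 z) + ψ))))) ∂((volume : Measure (κ →
            ℝ)).tilted fun z => -(1 / 2 * (z ⬝ᵥ z) + U (matrixCLM A (WithLp.toLp 2 z) + ψ)))) +
        (∫ w, (U' (matrixCLM A (WithLp.toLp 2 w) + ψ) (EuclideanSpace.single x₃ (1 : ℝ)) - (∫ w', U' (matrixCLM A (WithLp.toLp 2 w') + ψ)
            (EuclideanSpace.single x₃ (1 : ℝ)) ∂((volume : Measure (κ → ℝ)).tilted fun z => -(1 / 2 * (z ⬝ᵥ z) + U (matrixCLM A (WithLp.toLp 2 z) +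
            ψ))))) * (U' (matrixCLM A (WithLp.toLp 2 w) + ψ) (EuclideanSpace.single x₄ (1 : ℝ)) - (∫ w', U' (matrixCLM A (WithLp.toLp 2 w') + ψ)
            (EuclideanSpace.single x₄ (1 : ℝ)) ∂((volume : Measure (κ → ℝ)).tilted fun z => -(1 / 2 * (z ⬝ᵥ z) + U (matrixCLM A (WithLp.toLp 2 z) +
            ψ))))) ∂((volume : Measure (κ → ℝ)).tilted fun z => -(1 / 2 * (z ⬝ᵥ z) + U (matrixCLM A (WithLp.toLp 2 z) + ψ)))) * (∫ w, (U' (matrixCLM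
            A (WithLp.toLp 2 w) + ψ) (EuclideanSpace.single x₁ (1 : ℝ)) - (∫ w', U' (matrixCLM A (WithLp.toLp 2 w') + ψ) (EuclideanSpace.single x₁ (1
            : ℝ)) ∂((volume : Measure (κ → ℝ)).tilted fun z => -(1 / 2 * (z ⬝ᵥ z) + U (matrixCLM A (WithLp.toLp 2 z) + ψ))))) * (U' (matrixCLM A
            (WithLp.toLp 2 w) + ψ) (EuclideanSpace.single x₂ (1 : ℝ)) - (∫ w', U' (matrixCLM A (WithLp.toLp 2 w') + ψ) (EuclideanSpace.single x₂ (1 :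
            ℝ)) ∂((volume : Measure (κ → ℝ)).tilted fun z => -(1 / 2 * (z ⬝ᵥ z) + U (matrixCLM A (WithLp.toLp 2 z) + ψ))))) * (U' (matrixCLM A
            (WithLp.toLp 2 w) + ψ) (EuclideanSpace.single x₅ (1 : ℝ)) - (∫ w', U' (matrixCLM A (WithLp.toLp 2 w') + ψ) (EuclideanSpace.single x₅ (1 :
            ℝ)) ∂((volume : Measure (κ → ℝ)).tilted fun z => -(1 / 2 * (z ⬝ᵥ z) + U (matrixCLM A (WithLp.toLp 2 z) + ψ))))) ∂((volume : Measure (κ →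
            ℝ)).tilted fun z => -(1 / 2 * (z ⬝ᵥ z) + U (matrixCLM A (WithLp.toLp 2 z) + ψ)))) +
        (∫ w, (U' (matrixCLM A (WithLp.toLp 2 w) + ψ) (EuclideanSpace.single x₃ (1 : ℝ)) - (∫ w', U' (matrixCLM A (WithLp.toLp 2 w') + ψ)
            (EuclideanSpace.single x₃ (1 : ℝ)) ∂((volume : Measure (κ → ℝ)).tilted fun z => -(1 / 2 * (z ⬝ᵥ z) + U (matrixCLM A (WithLp.toLp 2 z) +
            ψ))))) * (U' (matrixCLM A (WithLp.toLp 2 w) + ψ) (EuclideanSpace.single x₅ (1 : ℝ)) - (∫ w', U' (matrixCLM A (WithLp.toLp 2 w') + ψ)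
            (EuclideanSpace.single x₅ (1 : ℝ)) ∂((volume : Measure (κ → ℝ)).tilted fun z => -(1 / 2 * (z ⬝ᵥ z) + U (matrixCLM A (WithLp.toLp 2 z) +
            ψ))))) ∂((volume : Measure (κ → ℝ)).tilted fun z => -(1 / 2 * (z ⬝ᵥ z) + U (matrixCLM A (WithLp.toLp 2 z) + ψ)))) * (∫ w, (U' (matrixCLM
            A (WithLp.toLp 2 w) + ψ) (EuclideanSpace.single x₁ (1 : ℝ)) - (∫ w', U' (matrixCLM A (WithLp.toLp 2 w') + ψ) (EuclideanSpace.single x₁ (1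
            : ℝ)) ∂((volume : Measure (κ → ℝ)).tilted fun z => -(1 / 2 * (z ⬝ᵥ z) + U (matrixCLM A (WithLp.toLp 2 z) + ψ))))) * (U' (matrixCLM A
            (WithLp.toLp 2 w) + ψ) (EuclideanSpace.single x₂ (1 : ℝ)) - (∫ w', U' (matrixCLM A (WithLp.toLp 2 w') + ψ) (EuclideanSpace.single x₂ (1 :
            ℝ)) ∂((volume : Measure (κ → ℝ)).tilted fun z => -(1 / 2 * (z ⬝ᵥ z) + U (matrixCLM A (WithLp.toLp 2 z) + ψ))))) * (U' (matrixCLM A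
            (WithLp.toLp 2 w) + ψ) (EuclideanSpace.single x₄ (1 : ℝ)) - (∫ w', U' (matrixCLM A (WithLp.toLp 2 w') + ψ) (EuclideanSpace.single x₄ (1 :
            ℝ)) ∂((volume : Measure (κ → ℝ)).tilted fun z => -(1 / 2 * (z ⬝ᵥ z) + U (matrixCLM A (WithLp.toLp 2 z) + ψ))))) ∂((volume : Measure (κ →
            ℝ)).tilted fun z => -(1 / 2 * (z ⬝ᵥ z) + U (matrixCLM A (WithLp.toLp 2 z) + ψ)))) +
        (∫ w, (U' (matrixCLM A (WithLp.toLp 2 w) + ψ) (EuclideanSpace.single x₄ (1 : ℝ)) - (∫ w', U' (matrixCLM A (WithLp.toLp 2 w') + ψ)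
            (EuclideanSpace.single x₄ (1 : ℝ)) ∂((volume : Measure (κ → ℝ)).tilted fun z => -(1 / 2 * (z ⬝ᵥ z) + U (matrixCLM A (WithLp.toLp 2 z) +
            ψ))))) * (U' (matrixCLM A (WithLp.toLp 2 w) + ψ) (EuclideanSpace.single x₅ (1 : ℝ)) - (∫ w', U' (matrixCLM A (WithLp.toLp 2 w') + ψ)
            (EuclideanSpace.single x₅ (1 : ℝ)) ∂((volume : Measure (κ → ℝ)).tilted fun z => -(1 / 2 * (z ⬝ᵥ z) + U (matrixCLM A (WithLp.toLp 2 z) +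
            ψ))))) ∂((volume : Measure (κ → ℝ)).tilted fun z => -(1 / 2 * (z ⬝ᵥ z) + U (matrixCLM A (WithLp.toLp 2 z) + ψ)))) * (∫ w, (U' (matrixCLM
            A (WithLp.toLp 2 w) + ψ) (EuclideanSpace.single x₁ (1 : ℝ)) - (∫ w', U' (matrixCLM A (WithLp.toLp 2 w') + ψ) (EuclideanSpace.single x₁ (1
            : ℝ)) ∂((volume : Measure (κ → ℝ)).tilted fun z => -(1 / 2 * (z ⬝ᵥ z) + U (matrixCLM A (WithLp.toLp 2 z) + ψ))))) * (U' (matrixCLM A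
            (WithLp.toLp 2 w) + ψ) (EuclideanSpace.single x₂ (1 : ℝ)) - (∫ w', U' (matrixCLM A (WithLp.toLp 2 w') + ψ) (EuclideanSpace.single x₂ (1 :
            ℝ)) ∂((volume : Measure (κ → ℝ)).tilted fun z => -(1 / 2 * (z ⬝ᵥ z) + U (matrixCLM A (WithLp.toLp 2 z) + ψ))))) * (U' (matrixCLM A
            (WithLp.toLp 2 w) + ψ) (EuclideanSpace.single x₃ (1 : ℝ)) - (∫ w', U' (matrixCLM A (WithLp.toLp 2 w') + ψ) (EuclideanSpace.single x₃ (1 :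
            ℝ)) ∂((volume : Measure (κ → ℝ)).tilted fun z => -(1 / 2 * (z ⬝ᵥ z) + U (matrixCLM A (WithLp.toLp 2 z) + ψ))))) ∂((volume : Measure (κ →
            ℝ)).tilted fun z => -(1 / 2 * (z ⬝ᵥ z) + U (matrixCLM A (WithLp.toLp 2 z) + ψ)))))| ≤
      ((4 * ((Real.exp (8 * μ * (R + R')) * (hr * αr)) * (1 - (Real.exp (8 * μ * (2 * R + R')) * (αc * hr * αr) / (1 - lamA)))⁻¹ * ((Real.exp (8 * μ
          * (R + R')) * (hr * αr)) * (1 - (Real.exp (8 * μ * (2 * R + R')) * (αc * hc * αr) / (1 - lamA)))⁻¹) / (1 - lamA)) + 5 * (50 * (κ₂ ^ 6 * γop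
          ^ 3) / (1 - lam * γop) ^ 3) + (((5 * (κ₂ ^ 4 * γop ^ 2) / (1 - lam * γop) ^ 2) + 1) / 2) * (5 * (κ₂ ^ 4 * γop ^ 2) / (1 - lam * γop) ^ 2) +
          2 * ((Real.exp (8 * μ * (R + R')) * (hr * αr)) * (1 - (Real.exp (8 * μ * (2 * R + R')) * (αc * hr * αr) / (1 - lamA)))⁻¹ * ((Real.exp (8 *
          μ * (R + R')) * (hr * αr)) * (1 - (Real.exp (8 * μ * (2 * R + R')) * (αc * hc * αr) / (1 - lamA)))⁻¹) / (1 - lamA)) * ((((5 * (κ₂ ^ 4 * γop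
          ^ 2) / (1 - lam * γop) ^ 2) + 1) / 2) + (5 * (κ₂ ^ 4 * γop ^ 2) / (1 - lam * γop) ^ 2)) + 24 * (((5 * (κ₂ ^ 4 * γop ^ 2) / (1 - lam * γop)
          ^ 2) + 1) / 2) * Real.sqrt (((Real.exp (8 * μ * (R + R')) * (hr * αr)) * (1 - (Real.exp (8 * μ * (2 * R + R')) * (αc * hr * αr) / (1 -
          lamA)))⁻¹ * ((Real.exp (8 * μ * (R + R')) * (hr * αr)) * (1 - (Real.exp (8 * μ * (2 * R + R')) * (αc * hc * αr) / (1 - lamA)))⁻¹) / (1 -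
          lamA)) * (5 * (κ₂ ^ 4 * γop ^ 2) / (1 - lam * γop) ^ 2))) + (6 * ((Real.exp (8 * μ * (R + R')) * (hr * αr)) * (1 - (Real.exp (8 * μ * (2 *
          R + R')) * (αc * hr * αr) / (1 - lamA)))⁻¹ * ((Real.exp (8 * μ * (R + R')) * (hr * αr)) * (1 - (Real.exp (8 * μ * (2 * R + R')) * (αc * hc
          * αr) / (1 - lamA)))⁻¹) / (1 - lamA)) + 5 * (50 * (κ₂ ^ 6 * γop ^ 3) / (1 - lam * γop) ^ 3) + ((((5 * (κ₂ ^ 4 * γop ^ 2) / (1 - lam * γop)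
          ^ 2) + 1) / 2) + (5 * (κ₂ ^ 4 * γop ^ 2) / (1 - lam * γop) ^ 2)) ^ 2 / 2 + 3 * (((5 * (κ₂ ^ 4 * γop ^ 2) / (1 - lam * γop) ^ 2) + 1) / 2) *
          (5 * (κ₂ ^ 4 * γop ^ 2) / (1 - lam * γop) ^ 2) + 3 * ((Real.exp (8 * μ * (R + R')) * (hr * αr)) * (1 - (Real.exp (8 * μ * (2 * R + R')) *
          (αc * hr * αr) / (1 - lamA)))⁻¹ * ((Real.exp (8 * μ * (R + R')) * (hr * αr)) * (1 - (Real.exp (8 * μ * (2 * R + R')) * (αc * hc * αr) / (1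
          - lamA)))⁻¹) / (1 - lamA)) * ((((5 * (κ₂ ^ 4 * γop ^ 2) / (1 - lam * γop) ^ 2) + 1) / 2) + (5 * (κ₂ ^ 4 * γop ^ 2) / (1 - lam * γop) ^ 2))
          + 12 * (((5 * (κ₂ ^ 4 * γop ^ 2) / (1 - lam * γop) ^ 2) + 1) / 2) * Real.sqrt (((Real.exp (8 * μ * (R + R')) * (hr * αr)) * (1 - (Real.exp
          (8 * μ * (2 * R + R')) * (αc * hr * αr) / (1 - lamA)))⁻¹ * ((Real.exp (8 * μ * (R + R')) * (hr * αr)) * (1 - (Real.exp (8 * μ * (2 * R +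
          R')) * (αc * hc * αr) / (1 - lamA)))⁻¹) / (1 - lamA)) * (5 * (κ₂ ^ 4 * γop ^ 2) / (1 - lam * γop) ^ 2)))) * (576 * S ^ 4) := by
  haveI : Nonempty ι := ⟨x₁⟩
  -- the Neumann `D` and its letters ((485)); θ ≥ 1, diagonal, submultiplicative ((476))
  have hθw1 : ∀ z w : κ, 1 ≤ (fun z w : κ => Real.exp (8 * μ * dist (q z) (q w))) z w := fun z w => expw_one_le (by linarith) (q z) (q w)
  have hθdiag : ∀ z : κ, (fun z w : κ => Real.exp (8 * μ * dist (q z) (q w))) z z = 1 := fun z => by simp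
  have hθmul : ∀ z y w : κ, (fun z w : κ => Real.exp (8 * μ * dist (q z) (q w))) z w ≤ (fun z w : κ => Real.exp (8 * μ * dist (q z) (q w))) z y *
      (fun z w : κ => Real.exp (8 * μ * dist (q z) (q w))) y w :=
    fun z y w => expw_triangle (by linarith) (q z) (q y) (q w)
  have hCθ := fun z => weighted_cross_rowsum_le hHk0 hαr hαc hhr hμ hAR hHkR hlamA1 z
  have hCθc := fun w => weighted_cross_colsum_le hHk0 hαr hαc hhc hμ hAR hHkR hlamA1 w
  have hD := neumannD_nonneg (A := A) hHk0 hlamA1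
  have hDC := neumannD_dominates (A := A) hHk0 hlamA1 hθw1 hCθ hγθ1
  have hDr := neumannD_weighted_rowsum (A := A) hHk0 hlamA1 hθw1 hθdiag hθmul hCθ hγθ1
  have hDc := neumannD_weighted_colsum (A := A) hHk0 hlamA1 hθw1 hθdiag hθmul hCθc hγθ'1
  have hdθ : 0 ≤ (1 - (Real.exp (8 * μ * (2 * R + R')) * (αc * hr * αr) / (1 - lamA)))⁻¹ := inv_nonneg.2 (by linarith)
  have hdθ' : 0 ≤ (1 - (Real.exp (8 * μ * (2 * R + R')) * (αc * hc * αr) / (1 - lamA)))⁻¹ := inv_nonneg.2 (by linarith)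
  have hαr0 : 0 ≤ αr := (Finset.sum_nonneg fun w _ => abs_nonneg (A x₁ w)).trans (hαr x₁)
  have hhr0 : 0 ≤ hr := (Finset.sum_nonneg fun u _ => hHk0 x₁ u).trans (hhr x₁)
  have hβ : 0 ≤ (Real.exp (8 * μ * (R + R')) * (hr * αr)) := mul_nonneg (Real.exp_pos _).le (mul_nonneg hhr0 hαr0)
  exact whitened_fifth_cumulant_row_letter (θ := (fun z w : κ => Real.exp (8 * μ * dist (q z) (q w)))) (σ := (fun x w => Real.exp (8 * μ * dist (p
      x) (q w)))) (r := (fun x y : ι => Real.exp (μ / 3 * dist (p x) (p y))))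
    (D := (fun x y : κ => ∑' n : ℕ, ((Matrix.of fun x w : κ => (if w = x then 0 else ∑ u, ∑ v, |A u w| * |A v x| * Hk v u) / (1 - lamA)) ^ n) x y))
    hΓop Y hUd hU'd hU''c hκ₀ hκ₁ ha hτ hδ hθ0 hθ1 hκθ hκθw hstab hU'b hU''b hlam hUsec hρg hHk hHk0 ψ hαr hαc hhr hlamA hlamA1 hγ hγ1 hD hDC
    (fun z w => (Real.exp_pos _).le) hDr hdθ hDc hdθ' (fun x w => (Real.exp_pos _).le) (fun x z w => sigma_theta hμ p q x z w)
    (fun x y => expw_one_le (by linarith) (p x) (p y)) (fun x y w => r_pow_24_le hμ p q x y w)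
    (fun v => weighted_obs_rowsum_le hHk0 hαr hhr hμ hAR hHkR v) hβ (fun v w => weighted_obs_entry_le hHk0 hαr hhr hμ hAR hHkR v w)
    (fun u v => by rw [dist_comm]) hS x₁

/-! ## Toy -/

/-- Toy (the site weight at distance zero is symmetric and equals one). -/
example (μ : ℝ) (a : X) : Real.exp (μ / 3 * dist a a) = 1 := by simp

end Summit.QuantumFields.BalabanUV.T4Continuum.NE7b.SupFiniteRangeFifthCumulant

end
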